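import Summits.CriticalPhenomena.PercolationContinuityZ3.Theorems.SahiAEOpenBandSupport

/-!
# Densities with zeros in every dimension: hyperplane sections and fullness after transport

Support file of the Sahi cell (`prim-sahi`, typer seat, generation 25; `--supports stmt-CriticalPhenomena-4575`).
Two small definitions (`lineSec`, `secSupp`), theorems otherwise; no named facts, no sorries.

Preliminaries of the structure theorem for densities with zeros in EVERY dimension (`SahiAEZeros.lean`; the planar
file is `SahiAEPlaneZerosPrelim.lean`, generation 24).  Hyperplane sections of `E ⊆ ℝ^ι` at height `t` in
direction `i` are handled as the CYLINDERS `lineSec E i t = {c | (c; i := t) ∈ E} ⊆ ℝ^ι` (the `i`-th coordinate of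
`c` is a dummy variable of infinite mass), which avoids products over `ι ∖ {i}`:

* `lintegral_volume_lineSec` — `∫ λ(lineSec E i t) dt = ⊤ · λ(E)` (Fubini and the dummy-coordinate identity
  `lintegral_lintegral_update`); hence null sets have null sections at almost every height;
* `secSupp S i` — the heights of the non-null sections; `S` lies almost everywhere over them (`ae_apply_mem_secSupp`);
* `top_mul_volume_cyl_inter` — for a cylinder `C` in direction `i`: `⊤ · λ(C ∩ {cᵢ ∈ A}) = λ(A) · λ(C)`;
* `ae_hyperplane_meets` — **fullness after transport**: if `S ⊆ ℝ^ι` lies almost everywhere over `∏ Xᵢ`, `Xᵢ` the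
  heights of its non-null sections (of positive measure), `νᵢ ~ λ|_{Xᵢ}` are probability measures and `L` coincides
  a.e. on the open unit cube with the preimage of `S` under the coordinatewise quantile map of `(νᵢ)`, then in every
  direction almost every hyperplane of the cube meets `L`.

No sorries, no new axioms.
-/

noncomputable section

namespace Summit.CriticalPhenomena.PercolationContinuityZ3.Theorems.SahiAEFourFunctions

open MeasureTheory Set Filter Topology Function Metric ProbabilityTheory
open scoped ENNReal NNReal

variable {ι : Type*} [Fintype ι] [DecidableEq ι]

/-! ### Cylinder sections -/

omit [Fintype ι] in
/-- **The cylinder section** of `E` at height `t` in direction `i`: the points whose projection onto the hyperplane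
`{zᵢ = t}` lies in `E`. [this work] -/
def lineSec (E : Set (ι → ℝ)) (i : ι) (t : ℝ) : Set (ι → ℝ) := {c | update c i t ∈ E}

omit [Fintype ι] in
/-- Membership in a cylinder section. [folklore] -/
theorem mem_lineSec {E : Set (ι → ℝ)} {i : ι} {t : ℝ} {c : ι → ℝ} : c ∈ lineSec E i t ↔ update c i t ∈ E := Iff.rfl

omit [Fintype ι] in
/-- Cylinder sections are invariant under changes of the dummy coordinate. [folklore] -/
theorem update_mem_lineSec_iff {E : Set (ι → ℝ)} {i : ι} {t s : ℝ} {c : ι → ℝ} :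
    update c i s ∈ lineSec E i t ↔ c ∈ lineSec E i t := by
  simp only [mem_lineSec, update_idem]

omit [Fintype ι] in
/-- Cylinder sections of measurable sets are measurable. [folklore] -/
theorem measurableSet_lineSec {E : Set (ι → ℝ)} (hE : MeasurableSet E) (i : ι) (t : ℝ) :
    MeasurableSet (lineSec E i t) :=
  (measurable_update'.comp (measurable_id.prodMk measurable_const)) hE

omit [Fintype ι] in
/-- The pulled-back set along `(c, t) ↦ (c; i := t)` is measurable. [folklore] -/
theorem measurableSet_updatePreimage {E : Set (ι → ℝ)} (hE : MeasurableSet E) (i : ι) :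
    MeasurableSet {q : (ι → ℝ) × ℝ | update q.1 i q.2 ∈ E} := measurable_update' hE

/-- The volume of the cylinder sections is measurable in the height. [folklore] -/
theorem measurable_volume_lineSec {E : Set (ι → ℝ)} (hE : MeasurableSet E) (i : ι) :
    Measurable fun t => (volume : Measure (ι → ℝ)) (lineSec E i t) :=
  measurable_measure_prodMk_right (μ := (volume : Measure (ι → ℝ))) (measurableSet_updatePreimage hE i)

/-- **The dummy-coordinate Fubini identity**: `∫ λ(lineSec E i t) dt = ⊤ · λ(E)`. [this work] -/
theorem lintegral_volume_lineSec {E : Set (ι → ℝ)} (hE : MeasurableSet E) (i : ι) :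
    ∫⁻ t, (volume : Measure (ι → ℝ)) (lineSec E i t) ∂(volume : Measure ℝ) = ⊤ * volume E := by
  have mEt := measurableSet_updatePreimage hE i
  have h1 : ((volume : Measure (ι → ℝ)).prod (volume : Measure ℝ)) {q | update q.1 i q.2 ∈ E} = ⊤ * volume E := by
    rw [Measure.prod_apply mEt]
    have e : ∀ x : ι → ℝ, (volume : Measure ℝ) (Prod.mk x ⁻¹' {q : (ι → ℝ) × ℝ | update q.1 i q.2 ∈ E}) =
        ∫⁻ r, E.indicator 1 (update x i r) ∂(volume : Measure ℝ) := by
      intro x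
      have ex : Prod.mk x ⁻¹' {q : (ι → ℝ) × ℝ | update q.1 i q.2 ∈ E} = (update x i) ⁻¹' E := rfl
      rw [ex, ← lintegral_indicator_one ((measurable_update x) hE)]
      rfl
    simp_rw [e]
    rw [SahiAESeparableTilt.lintegral_lintegral_update i (measurable_one.indicator hE), lintegral_indicator_one hE]
  rw [← h1, Measure.prod_apply_symm mEt]
  rfl

/-- **Null sets have null cylinder sections at almost every height.** [folklore] -/
theorem ae_volume_lineSec_eq_zero {E : Set (ι → ℝ)} (hE : MeasurableSet E) (h0 : volume E = 0) (i : ι) :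
    ∀ᵐ t ∂(volume : Measure ℝ), (volume : Measure (ι → ℝ)) (lineSec E i t) = 0 := by
  have h := lintegral_volume_lineSec hE i
  rw [h0, mul_zero] at h
  exact (lintegral_eq_zero_iff (measurable_volume_lineSec hE i)).1 h

/-- **Cylinders meet coordinate slabs in proportion**: for a cylinder `C` in direction `i` (invariant under changes
of the `i`-th coordinate) and `A ⊆ ℝ`, `⊤ · λ(C ∩ {cᵢ ∈ A}) = λ(A) · λ(C)`. [this work] -/
theorem top_mul_volume_cyl_inter {C : Set (ι → ℝ)} (hC : MeasurableSet C) {i : ι}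
    (hinv : ∀ c : ι → ℝ, ∀ t : ℝ, c ∈ C → update c i t ∈ C) {A : Set ℝ} (hA : MeasurableSet A) :
    ⊤ * volume (C ∩ {c | c i ∈ A}) = volume A * volume C := by
  have mCA : MeasurableSet (C ∩ {c : ι → ℝ | c i ∈ A}) := hC.inter (measurable_pi_apply i hA)
  have hiff : ∀ (c : ι → ℝ) (t : ℝ), update c i t ∈ C ↔ c ∈ C := fun c t =>
    ⟨fun h => by simpa using hinv _ (c i) h, fun h => hinv c t h⟩
  have h := SahiAESeparableTilt.lintegral_lintegral_update i (measurable_one.indicator mCA)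
  rw [lintegral_indicator_one mCA] at h
  rw [← h]
  have e : ∀ x : ι → ℝ, ∫⁻ r, (C ∩ {c : ι → ℝ | c i ∈ A}).indicator (1 : (ι → ℝ) → ℝ≥0∞) (update x i r)
      ∂(volume : Measure ℝ) = C.indicator 1 x * volume A := by
    intro x
    by_cases hx : x ∈ C
    · rw [Set.indicator_of_mem hx, Pi.one_apply, one_mul, ← lintegral_indicator_one hA]
      refine lintegral_congr fun r => ?_
      by_cases hr : r ∈ A
      · rw [Set.indicator_of_mem (show update x i r ∈ C ∩ {c : ι → ℝ | c i ∈ A} from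
          ⟨(hiff x r).2 hx, by simpa using hr⟩), Set.indicator_of_mem hr]
        rfl
      · rw [Set.indicator_of_notMem (fun h => hr (by simpa using h.2)), Set.indicator_of_notMem hr]
    · rw [Set.indicator_of_notMem hx, zero_mul]
      refine (lintegral_eq_zero_iff' ?_).2 (Eventually.of_forall fun r => ?_)
      · exact ((measurable_one.indicator mCA).comp (measurable_update x)).aemeasurable
      · exact Set.indicator_of_notMem (fun h => hx ((hiff x r).1 h.1)) _
  simp_rw [e]
  rw [lintegral_mul_const _ (measurable_one.indicator hC), lintegral_indicator_one hC, mul_comm]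

/-! ### Heights of the non-null sections -/

/-- **The heights of the non-null cylinder sections** of `S` in direction `i`. [this work] -/
def secSupp (S : Set (ι → ℝ)) (i : ι) : Set ℝ := {a | (volume : Measure (ι → ℝ)) (lineSec S i a) ≠ 0}

/-- The height set is measurable. [folklore] -/
theorem measurableSet_secSupp {S : Set (ι → ℝ)} (hS : MeasurableSet S) (i : ι) : MeasurableSet (secSupp S i) :=
  (measurable_volume_lineSec hS i (measurableSet_singleton 0)).compl

/-- **A set lies almost everywhere over the heights of its non-null sections.** [folklore] -/
theorem ae_apply_mem_secSupp {S : Set (ι → ℝ)} (hS : MeasurableSet S) (i : ι) :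
    ∀ᵐ x ∂(volume : Measure (ι → ℝ)), x ∈ S → x i ∈ secSupp S i := by
  set D : Set (ι → ℝ) := S ∩ {x | x i ∉ secSupp S i} with hD
  have mD : MeasurableSet D :=
    hS.inter (show MeasurableSet {x : ι → ℝ | x i ∉ secSupp S i} from
      (measurableSet_secSupp hS i).compl.preimage (measurable_pi_apply i))
  have hsec : ∀ t, (volume : Measure (ι → ℝ)) (lineSec D i t) = 0 := fun t => by
    by_cases ht : t ∈ secSupp S i
    · have : lineSec D i t = ∅ := by
        ext c; simp only [mem_lineSec, hD, Set.mem_inter_iff, Set.mem_setOf_eq, update_self, Set.mem_empty_iff_false,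
          iff_false, not_and, not_not]
        exact fun _ => ht
      rw [this, measure_empty]
    · have hsub : lineSec D i t ⊆ lineSec S i t := fun c hc => hc.1
      simp only [secSupp, Set.mem_setOf_eq, not_not] at ht
      exact measure_mono_null hsub ht
  have h := lintegral_volume_lineSec mD i
  simp_rw [hsec] at h
  rw [lintegral_zero] at h
  have hD0 : volume D = 0 := by
    have := h.symm
    simpa using this
  rw [ae_iff]
  refine measure_mono_null (fun x hx => ?_) hD0
  simp only [Set.mem_setOf_eq, Classical.not_imp] at hx
  exact ⟨hx.1, hx.2⟩

/-! ### Fullness after transport -/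

omit [Fintype ι] in
/-- The coordinatewise map commutes with updating a coordinate. [folklore] -/
theorem update_comp_coordwise {g : ι → ℝ → ℝ} (c : ι → ℝ) (i : ι) (s : ℝ) :
    (fun k => g k (update c i s k)) = update (fun k => g k (c k)) i (g i s) := by
  funext k
  by_cases hk : k = i
  · subst hk; simp
  · simp [hk]

/-- **Fullness after transport.**  Let `S ⊆ ℝ^ι` be measurable with heights of non-null sections `Xᵢ = secSupp S i`
of positive measure, `νᵢ ≪ λ|_{Xᵢ}` probability measures with `⊗ λ|_{Xᵢ} ≪ ⊗ νᵢ`, and `L` a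
measurable set which on the open
unit cube coincides almost everywhere with the preimage of `S` under the coordinatewise quantile map of `(νᵢ)`.
Then in every direction almost every hyperplane of the cube meets `L`. [this work] -/
theorem ae_hyperplane_meets {S : Set (ι → ℝ)} (mS : MeasurableSet S)
    (hX0 : ∀ i, (volume : Measure ℝ) (secSupp S i) ≠ 0)
    (ν : ι → Measure ℝ) [∀ i, IsProbabilityMeasure (ν i)]
    (hν : ∀ i, ν i ≪ (volume : Measure ℝ).restrict (secSupp S i))
    (hρν : Measure.pi (fun k => (volume : Measure ℝ).restrict (secSupp S k)) ≪ Measure.pi ν)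
    {L : Set (ι → ℝ)} (mL : MeasurableSet L)
    (hLS : ∀ᵐ u ∂(volume : Measure (ι → ℝ)), u ∈ Set.pi univ (fun _ => Ioo (0 : ℝ) 1) →
      (u ∈ L ↔ (fun k => rqe (ν k) (u k)) ∈ S)) (i : ι) :
    ∀ᵐ s ∂(volume : Measure ℝ), s ∈ Ioo (0 : ℝ) 1 → ∃ z ∈ L, z i = s := by
  set X : ι → Set ℝ := fun k => secSupp S k with hX
  have mX : ∀ k, MeasurableSet (X k) := fun k => measurableSet_secSupp mS k
  set P : Set (ι → ℝ) := Set.pi univ X with hP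
  have mP : MeasurableSet P := MeasurableSet.univ_pi mX
  set U : Set (ι → ℝ) := Set.pi univ fun _ => Ioo (0 : ℝ) 1 with hU
  have mU : MeasurableSet U := MeasurableSet.univ_pi fun _ => measurableSet_Ioo
  set T : (ι → ℝ) → (ι → ℝ) := fun u k => rqe (ν k) (u k) with hT
  have hT_meas : Measurable T := measurable_pi_iff.2 fun k => (measurable_rqe (ν k)).comp (measurable_pi_apply k)
  set S' : Set (ι → ℝ) := T ⁻¹' S with hS'
  have mS' : MeasurableSet S' := hT_meas mS
  -- reference measures
  set ρ : ι → Measure ℝ := fun k => (volume : Measure ℝ).restrict (X k) with hρ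
  have hpiρ : Measure.pi ρ = (volume : Measure (ι → ℝ)).restrict P := by
    rw [hP, volume_pi, Measure.restrict_pi_pi]
  set μ₁ : Measure (ι → ℝ) := (volume : Measure (ι → ℝ)).restrict U with hμ₁
  have hμ₁pi : μ₁ = Measure.pi fun _ : ι => (volume : Measure ℝ).restrict (Ioo (0 : ℝ) 1) := by
    rw [hμ₁, hU, volume_pi, Measure.restrict_pi_pi]
  have hTmp : MeasurePreserving T μ₁ (Measure.pi ν) := by
    rw [hμ₁pi]
    exact measurePreserving_pi _ _ fun k => measurePreserving_rqe (ν k)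
  -- (a)-(d): for `λ|_{Xᵢ}`-a.e. height the section of `S` has positive `pi ν`-measure
  have hSP : volume (S \ P) = 0 := by
    refine measure_eq_zero_iff_ae_notMem.2 ?_
    filter_upwards [ae_all_iff.2 fun k => ae_apply_mem_secSupp mS k] with x hx h
    exact h.2 (Set.mem_univ_pi.2 fun k => hx k h.1)
  have ha : ∀ᵐ a ∂(volume : Measure ℝ).restrict (X i), (Measure.pi ν) (lineSec S i a) ≠ 0 := by
    have h1 : ∀ᵐ a ∂(volume : Measure ℝ).restrict (X i),
        a ∈ X i ∧ (volume : Measure (ι → ℝ)) (lineSec (S \ P) i a) = 0 :=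
      (ae_restrict_mem (mX i)).and (ae_restrict_of_ae (ae_volume_lineSec_eq_zero (mS.diff mP) hSP i))
    filter_upwards [h1] with a ha
    -- the section of `S ∩ P` is non-null
    have h2 : (volume : Measure (ι → ℝ)) (lineSec (S ∩ P) i a) ≠ 0 := by
      intro h0
      have hsub : lineSec S i a ⊆ lineSec (S ∩ P) i a ∪ lineSec (S \ P) i a := fun c hc => by
        by_cases hcP : update c i a ∈ P
        · exact Or.inl ⟨hc, hcP⟩
        · exact Or.inr ⟨hc, hcP⟩
      exact ha.1 (measure_mono_null hsub (measure_union_null h0 ha.2))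
    -- hence so is its part over `Xᵢ`, which lies in `lineSec S i a ∩ P`
    have mC : MeasurableSet (lineSec (S ∩ P) i a) := measurableSet_lineSec (mS.inter mP) i a
    have h3 : volume (lineSec (S ∩ P) i a ∩ {c : ι → ℝ | c i ∈ X i}) ≠ 0 := by
      intro h0
      have h4 := top_mul_volume_cyl_inter mC (fun c t hc => update_mem_lineSec_iff.2 hc) (mX i)
      rw [h0, mul_zero] at h4
      rcases mul_eq_zero.1 h4.symm with h5 | h5
      · exact hX0 i h5
      · exact h2 h5
    have hsub : lineSec (S ∩ P) i a ∩ {c : ι → ℝ | c i ∈ X i} ⊆ lineSec S i a ∩ P := by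
      rintro c ⟨hc, hci⟩
      refine ⟨hc.1, Set.mem_univ_pi.2 fun k => ?_⟩
      by_cases hk : k = i
      · subst hk; exact hci
      · have := Set.mem_univ_pi.1 hc.2 k; rwa [update_of_ne hk] at this
    have h5 : (Measure.pi ρ) (lineSec S i a) ≠ 0 := by
      rw [hpiρ, Measure.restrict_apply (measurableSet_lineSec mS i a)]
      exact fun h0 => h3 (measure_mono_null hsub h0)
    exact fun h0 => h5 (hρν h0)
  -- (e) transfer to the heights of the cube
  have hb : ∀ᵐ s ∂(volume : Measure ℝ).restrict (Ioo (0 : ℝ) 1), (Measure.pi ν) (lineSec S i (rqe (ν i) s)) ≠ 0 :=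
    (measurePreserving_rqe (ν i)).quasiMeasurePreserving.ae ((hν i).ae_le ha)
  -- (f) the sections of `S'` pulled back
  have hc' : ∀ s, lineSec S' i s = T ⁻¹' lineSec S i (rqe (ν i) s) := fun s => by
    ext c
    simp only [mem_lineSec, hS', Set.mem_preimage, hT]
    rw [update_comp_coordwise (g := fun k => rqe (ν k)) c i s]
  have hd : ∀ s, μ₁ (lineSec S' i s) = (Measure.pi ν) (lineSec S i (rqe (ν i) s)) := fun s => by
    rw [hc' s]
    exact hTmp.measure_preimage (measurableSet_lineSec mS i _).nullMeasurableSet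
  -- (g) the sections of `L` and `S'` agree at almost every height
  set D : Set (ι → ℝ) := U ∩ {u | ¬(u ∈ L ↔ u ∈ S')} with hD
  have mD : MeasurableSet D := by
    have : {u : ι → ℝ | ¬(u ∈ L ↔ u ∈ S')} = (L \ S') ∪ (S' \ L) := by
      ext u; simp only [Set.mem_setOf_eq, Set.mem_union, Set.mem_sdiff]; tauto
    rw [hD, this]; exact mU.inter ((mL.diff mS').union (mS'.diff mL))
  have hD0 : volume D = 0 :=
    measure_eq_zero_iff_ae_notMem.2 (by filter_upwards [hLS] with u hu h using h.2 (hu h.1))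
  have hg := ae_volume_lineSec_eq_zero mD hD0 i
  have hb' := (ae_restrict_iff' (measurableSet_Ioo (a := (0 : ℝ)) (b := 1))).1 hb
  filter_upwards [hg, hb'] with s hsD hsb hsI
  -- (h) the section of `L` at `s` is non-null, hence non-empty
  have hsub : lineSec S' i s ∩ U ⊆ lineSec L i s ∪ lineSec D i s := by
    rintro c ⟨hc, hcU⟩
    have hcU' : update c i s ∈ U := Set.mem_univ_pi.2 fun k => by
      by_cases hk : k = i
      · subst hk; simpa using hsI
      · rw [update_of_ne hk]; exact Set.mem_univ_pi.1 hcU k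
    by_cases hcL : update c i s ∈ L
    · exact Or.inl hcL
    · exact Or.inr ⟨hcU', fun h => hcL (h.2 hc)⟩
  have hpos : volume (lineSec S' i s ∩ U) ≠ 0 := by
    rw [← Measure.restrict_apply (measurableSet_lineSec mS' i s), ← hμ₁, hd s]
    exact hsb hsI
  have hL0 : volume (lineSec L i s) ≠ 0 := fun h0 => hpos (measure_mono_null hsub (measure_union_null h0 hsD))
  obtain ⟨c, hc⟩ := nonempty_of_measure_ne_zero hL0
  exact ⟨update c i s, hc, update_self ..⟩

end Summit.CriticalPhenomena.PercolationContinuityZ3.Theorems.SahiAEFourFunctions
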